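import Literature.AlgebraicGeometry.HodgeTheory.VHSDataHodgeGenericPointsDescent
import Literature.AlgebraicGeometry.HodgeTheory.VHSDataHodgeClassesAlongPathsTensorConstructions
import Literature.AlgebraicGeometry.Motives.FamiliesVHSProdMorphism
import Literature.AlgebraicGeometry.Motives.FamiliesVHSTensorMorphism
import HarnessLib

/-!
# Exceptional Hodge loci grow and Hodge-generic loci shrink along RETRACTS of VHS data (`π ∘ ι = id`); the tensor constructions of a retract are retracts;
# hence a point Hodge-generic for a direct sum `D₁ ⊕ D₂` is Hodge-generic for both summands

Topic `Literature/AlgebraicGeometry/HodgeTheory` (namespace `Literature.AlgebraicGeometry.Motives.VHSData`), lane `lit-hodgefound` (seat `p08`, row g61-#14);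
sequel of `VHSDataHodgeClassesAlongPathsDescent` (`Hom.isHodgeAlong_app`: morphisms preserve generic classes), `VHSDataHodgeGenericPoints` (`hodgeGenericLocus`)
over the tree's functorial tensor constructions of morphisms (`Motives/FamiliesVHSTensorMorphism`: `Hom.tensor`, `Hom.dualMap`, `Hom.tensor_comp ∕ _id`,
`Hom.dualMap_comp ∕ _id`; `Motives/FamiliesVHSTensorPower`: `Hom.tensorPow`, `Hom.tensorPow_comp ∕ _id`) and the direct-sum morphisms
(`Motives/FamiliesVHSProdMorphism`: `Hom.inl ∕ fst ∕ inr ∕ snd`, `Hom.fst_comp_inl`, `Hom.snd_comp_inr`).  THEOREMS ONLY — no definition, no named fact, no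
instance (D-0026 net debt `0`).

PRINTED SOURCES.  C. Voisin, *Hodge Theory II*, §5.3.1 (Hodge loci are functorial: a morphism of variations carries classes of type `(p,p)` to classes of type
`(p,p)`), §5.3.3; P. Deligne, *Théorie de Hodge II*, 2.1 (direct sums, sub-objects), 1.1.12 (tensor functoriality); P. Deligne, LNM 900 (1982), I §3, 3.1
(the `T^{a,b}` are functorial in `V` for isomorphisms — here for retract pairs, using `ι` on `V` and `π^∨` on `V^∨`); M. Green, P. Griffiths, M. Kerr (2012),
Ch. III (III.2) (Hodge-generic points).

CONTENT.
* §1 RETRACTS `ι : D → D'`, `π : D' → D`, `π ∘ ι = id`: `app_comp_app_eq_self_of_comp_eq_id`, **`isHodgeAlong_app_iff_of_comp_eq_id`** (`u` is generic iff `ι u`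
  is), **`exceptionalHodgeLocus_subset_of_comp_eq_id`** (`exceptionalHodgeLocus D ⊆ exceptionalHodgeLocus D'`), `genericHodgeClasses`-free.
* §2 TENSOR CONSTRUCTIONS OF A RETRACT: `tensorPow_comp_tensorPow_eq_id`, `dualMap_comp_dualMap_eq_id` (`ι^∨ ∘ π^∨ = id`), **`tensorSpaceMap_comp_eq_id`**
  (`(π^{⊗a} ⊗ (ι^∨)^{⊗b}) ∘ (ι^{⊗a} ⊗ (π^∨)^{⊗b}) = id` on `T^{a,b}`), **`exceptionalHodgeLocus_tensorSpace_subset_of_comp_eq_id`**,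
  **`hodgeGenericLocus_subset_of_comp_eq_id`** (`hodgeGenericLocus D' ⊆ hodgeGenericLocus D`: HODGE-GENERIC POINTS OF `D'` ARE HODGE-GENERIC FOR EVERY RETRACT `D`).
* §3 DIRECT SUMS: **`hodgeGenericLocus_prod_subset`** (`hodgeGenericLocus (D₁ ⊕ D₂) ⊆ hodgeGenericLocus D₁ ∩ hodgeGenericLocus D₂`),
  `exceptionalHodgeLocus_tensorSpace_union_subset_prod` (`exc(T^{a,b}D₁) ∪ exc(T^{a,b}D₂) ⊆ exc(T^{a,b}(D₁ ⊕ D₂))`), and the pointwise forms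
  `isHodgeAlong_univ_tensorSpace_left ∕ _right_of_mem_hodgeGenericLocus_prod`, `isHodgeAlong_univ_left_of_mem_hodgeGenericLocus_prod`.

HONEST SCOPE.  The reverse inclusions of §3 fail in general (mixed tensors of `D₁ ⊕ D₂`); nothing analytic is involved.

## References

* [VoisinHodgeII2003] C. Voisin, *Hodge Theory and Complex Algebraic Geometry II*, CUP (2003), §5.3.1, §5.3.3.
* [DeligneHodgeII1971] P. Deligne, *Théorie de Hodge II*, Publ. Math. IHÉS 40 (1971), 1.1.12, 2.1.
* [Deligne1982HodgeCycles] P. Deligne, *Hodge cycles on abelian varieties*, LNM 900 (1982), I §3, 3.1.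
* [GreenGriffithsKerr2012] M. Green, P. Griffiths, M. Kerr, *Mumford–Tate Groups and Domains*, Ann. of Math. Studies 183 (2012), Ch. III, (III.2).
* [DeligneMilne1982Tannakian] P. Deligne, J. Milne, *Tannakian categories*, LNM 900 (1982), §1, 1.5–1.6.
-/

noncomputable section

open _root_.Topology _root_.Filter Set

namespace Literature.AlgebraicGeometry

open Motives Motives.HodgeStructure HodgeTheory Topology

namespace Motives.VHSData

variable {S : Type} [TopologicalSpace S] {k : ℤ}

/-! ## §1 Retracts of VHS data -/

section Retract

variable {D D' : VHSData S k} {ι : Hom D D'} {π : Hom D' D}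

/-- `π_s (ι_s u) = u` for a retract pair. [cite: DeligneHodgeII1971, 2.1] -/
theorem app_comp_app_eq_self_of_comp_eq_id (h : π.comp ι = Hom.id D) (s : S) (u : D.VZ.fiber s) : π.app s (ι.app s u) = u := by
  have h' := congrArg (fun χ : Hom D D => χ.app s u) h
  simpa only [Hom.comp_app, LinearMap.comp_apply, Hom.id_app, LinearMap.id_apply] using h'

/-- **Along a retract `u` is generic iff `ι u` is** (morphisms preserve generic classes; `π ι = id`). [cite: VoisinHodgeII2003, §5.3.1] [cite: DeligneHodgeII1971, 2.1] -/
theorem isHodgeAlong_app_iff_of_comp_eq_id (h : π.comp ι = Hom.id D) {p : ℤ} {s : S} (u : D.VZ.fiber s) (W : Set S) :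
    D'.IsHodgeAlong p (ι.app s u) W ↔ D.IsHodgeAlong p u W := by
  refine ⟨fun hu => ?_, fun hu => ι.isHodgeAlong_app hu⟩
  have h' := π.isHodgeAlong_app hu
  rwa [app_comp_app_eq_self_of_comp_eq_id h] at h'

/-- **THE EXCEPTIONAL LOCUS GROWS ALONG A RETRACT**: `exceptionalHodgeLocus D p ⊆ exceptionalHodgeLocus D' p` (`ι u` is of type `(p,p)` at `s` and not generic
when `u` is so). [cite: VoisinHodgeII2003, §5.3.1 and §5.3.3] [cite: DeligneHodgeII1971, 2.1] -/
theorem exceptionalHodgeLocus_subset_of_comp_eq_id (h : π.comp ι = Hom.id D) (p : ℤ) : D.exceptionalHodgeLocus p ⊆ D'.exceptionalHodgeLocus p := by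
  rintro s ⟨u, hu, hnot⟩
  exact ⟨ι.app s u, ι.isHodgeAt_app hu, fun hgen => hnot ((isHodgeAlong_app_iff_of_comp_eq_id h u univ).1 hgen)⟩

end Retract

/-! ## §2 The tensor constructions of a retract are retracts -/

section TensorRetract

variable {D D' : VHSData S k} {ι : Hom D D'} {π : Hom D' D}

/-- `π^{⊗a} ∘ ι^{⊗a} = id`. [cite: DeligneMilne1982Tannakian, §1, 1.5–1.6] -/
theorem tensorPow_comp_tensorPow_eq_id (h : π.comp ι = Hom.id D) (a : ℕ) : (Hom.tensorPow π a).comp (Hom.tensorPow ι a) = Hom.id (D.tensorPow a) := by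
  rw [← Hom.tensorPow_comp, h, Hom.tensorPow_id]

/-- `ι^∨ ∘ π^∨ = (π ∘ ι)^∨ = id`. [cite: DeligneHodgeII1971, 1.1.12] -/
theorem dualMap_comp_dualMap_eq_id (h : π.comp ι = Hom.id D) : ι.dualMap.comp π.dualMap = Hom.id D.dual := by
  rw [← Hom.dualMap_comp, h, Hom.dualMap_id]

/-- **`T^{a,b}` OF A RETRACT IS A RETRACT**: `(π^{⊗a} ⊗ (ι^∨)^{⊗b}) ∘ (ι^{⊗a} ⊗ (π^∨)^{⊗b}) = id` on `T^{a,b}D = D^{⊗a} ⊗ (D^∨)^{⊗b}`.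
[cite: Deligne1982HodgeCycles, I §3, 3.1] [cite: DeligneHodgeII1971, 1.1.12] -/
theorem tensorSpaceMap_comp_eq_id (h : π.comp ι = Hom.id D) (a b : ℕ) :
    ((Hom.tensorPow π a).tensor (Hom.tensorPow ι.dualMap b)).comp ((Hom.tensorPow ι a).tensor (Hom.tensorPow π.dualMap b)) =
      Hom.id ((D.tensorPow a).tensor (D.dual.tensorPow b)) := by
  rw [← Hom.tensor_comp, tensorPow_comp_tensorPow_eq_id h, ← Hom.tensorPow_comp, dualMap_comp_dualMap_eq_id h, Hom.tensorPow_id]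
  exact Hom.tensor_id

/-- **The exceptional loci of the `T^{a,b}` grow along a retract.** [cite: VoisinHodgeII2003, §5.3.3] [cite: Deligne1982HodgeCycles, I §3, 3.1] -/
theorem exceptionalHodgeLocus_tensorSpace_subset_of_comp_eq_id (h : π.comp ι = Hom.id D) (a b : ℕ) (p : ℤ) :
    (D.tensorSpace a b).exceptionalHodgeLocus p ⊆ (D'.tensorSpace a b).exceptionalHodgeLocus p :=
  exceptionalHodgeLocus_subset_of_comp_eq_id (D := D.tensorSpace a b) (D' := D'.tensorSpace a b)
    (ι := (Hom.tensorPow ι a).tensor (Hom.tensorPow π.dualMap b)) (π := (Hom.tensorPow π a).tensor (Hom.tensorPow ι.dualMap b))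
    (tensorSpaceMap_comp_eq_id h a b) p

/-- **HODGE-GENERIC POINTS OF `D'` ARE HODGE-GENERIC FOR EVERY RETRACT `D` OF `D'`.** [cite: GreenGriffithsKerr2012, Ch. III (III.2)] [cite: VoisinHodgeII2003, §5.3.3] -/
theorem hodgeGenericLocus_subset_of_comp_eq_id (h : π.comp ι = Hom.id D) : D'.hodgeGenericLocus ⊆ D.hodgeGenericLocus :=
  fun _ hs a b p hp hmem => hs a b p hp (exceptionalHodgeLocus_tensorSpace_subset_of_comp_eq_id h a b p hmem)

end TensorRetract

/-! ## §3 Direct sums -/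

section Prod

variable (D₁ D₂ : VHSData S k)

/-- **A POINT HODGE-GENERIC FOR `D₁ ⊕ D₂` IS HODGE-GENERIC FOR `D₁` AND FOR `D₂`** (both are retracts of the sum). [cite: GreenGriffithsKerr2012, Ch. III (III.2)]
[cite: DeligneHodgeII1971, 2.1] -/
theorem hodgeGenericLocus_prod_subset : (D₁.prod D₂).hodgeGenericLocus ⊆ D₁.hodgeGenericLocus ∩ D₂.hodgeGenericLocus := fun _ hs =>
  ⟨hodgeGenericLocus_subset_of_comp_eq_id (Hom.fst_comp_inl (D₁ := D₁) (D₂ := D₂)) hs,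
    hodgeGenericLocus_subset_of_comp_eq_id (Hom.snd_comp_inr (D₁ := D₁) (D₂ := D₂)) hs⟩

/-- `exc(T^{a,b}D₁) ∪ exc(T^{a,b}D₂) ⊆ exc(T^{a,b}(D₁ ⊕ D₂))`. [cite: VoisinHodgeII2003, §5.3.3] [cite: DeligneHodgeII1971, 2.1] -/
theorem exceptionalHodgeLocus_tensorSpace_union_subset_prod (a b : ℕ) (p : ℤ) :
    (D₁.tensorSpace a b).exceptionalHodgeLocus p ∪ (D₂.tensorSpace a b).exceptionalHodgeLocus p ⊆ ((D₁.prod D₂).tensorSpace a b).exceptionalHodgeLocus p :=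
  union_subset (exceptionalHodgeLocus_tensorSpace_subset_of_comp_eq_id (Hom.fst_comp_inl (D₁ := D₁) (D₂ := D₂)) a b p)
    (exceptionalHodgeLocus_tensorSpace_subset_of_comp_eq_id (Hom.snd_comp_inr (D₁ := D₁) (D₂ := D₂)) a b p)

/-- Pointwise: at a point Hodge-generic for `D₁ ⊕ D₂` every Hodge class of every `T^{a,b}D₁` is generic. [cite: GreenGriffithsKerr2012, Ch. III (III.2)] -/
theorem isHodgeAlong_univ_tensorSpace_left_of_mem_hodgeGenericLocus_prod {s : S} (hs : s ∈ (D₁.prod D₂).hodgeGenericLocus) (a b : ℕ) {p : ℤ}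
    (hp : p + p = (a : ℤ) * k + (b : ℤ) * (-k)) {u : (D₁.tensorSpace a b).VZ.fiber s} (hu : (D₁.tensorSpace a b).IsHodgeAt s p u) :
    (D₁.tensorSpace a b).IsHodgeAlong p u univ :=
  D₁.isHodgeAlong_univ_of_mem_hodgeGenericLocus ((D₁.hodgeGenericLocus_prod_subset D₂ hs).1) a b hp hu

/-- The same for the second summand. [cite: GreenGriffithsKerr2012, Ch. III (III.2)] -/
theorem isHodgeAlong_univ_tensorSpace_right_of_mem_hodgeGenericLocus_prod {s : S} (hs : s ∈ (D₁.prod D₂).hodgeGenericLocus) (a b : ℕ) {p : ℤ}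
    (hp : p + p = (a : ℤ) * k + (b : ℤ) * (-k)) {u : (D₂.tensorSpace a b).VZ.fiber s} (hu : (D₂.tensorSpace a b).IsHodgeAt s p u) :
    (D₂.tensorSpace a b).IsHodgeAlong p u univ :=
  D₂.isHodgeAlong_univ_of_mem_hodgeGenericLocus ((D₁.hodgeGenericLocus_prod_subset D₂ hs).2) a b hp hu

/-- **The summand `D₁` itself at a point Hodge-generic for `D₁ ⊕ D₂`**: every Hodge class of `D₁` of level `p` (`2p = k`) is generic.
[cite: GreenGriffithsKerr2012, Ch. III (III.2)] [cite: DeligneHodgeII1971, 2.1] -/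
theorem isHodgeAlong_univ_left_of_mem_hodgeGenericLocus_prod {s : S} (hs : s ∈ (D₁.prod D₂).hodgeGenericLocus) {p : ℤ} (hp : p + p = k)
    {u : D₁.VZ.fiber s} (hu : D₁.IsHodgeAt s p u) : D₁.IsHodgeAlong p u univ :=
  isHodgeAlong_univ_of_mem_hodgeGenericLocus_self ((D₁.hodgeGenericLocus_prod_subset D₂ hs).1) hp hu

end Prod

end Motives.VHSData

end Literature.AlgebraicGeometry

end
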